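import Summits.Parity.BatemanHorn.Theorems.SelbergDelangeRigidityLSDRealSegmentTailsTwoEngine
import HarnessLib

/-!
# Route `SelbergDelangeRigidity`, crux `LSDRealSegment` (stmt-Parity-9770), line
# `product-anatomy-subcritical`: clause (a) of `stub_tailsTwo` — the a priori bound in total degree `2`

`tailsTwo_aPrioriBound_of_facts` (registered helper; CONDITIONAL on the named facts (NT) `NairTenenbaum1998_theorem1`
and (R) `BugeaudEvertseGyory2018_SPartPolynomialValues`): for every Bateman–Horn system of total degree `2` (one
irreducible quadratic, or a pair of non-associated linear forms) and every `1 ≤ y < 2`,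
`Σ_{n ≤ x} y^{Ω_f(n)} ≤ C x (log x)^{k(y−1)}` (`APrioriBound k f y`).  Proof: the restoration engine
(`tailsTwo_engine`) with the peeled weights `Fᵢ = y^{Ω(roughPart P ·)}` (class `𝓜(y, 1, ε₁)` once `P^{ε₁} ≥ y`,
`tails_peeledWeight_isClassM`) and all slices; the harmonic factors are `≪ (log X)^y` (`tails_rootCountHarmonic_le`);
the class densities satisfy `#classes(s)/M(s) ≤ K_z/∏ sᵢ` (`tailsTwo_classDensity_le`: for a pair,
`gcd(s₁, s₂)` divides the resultant), so `Z ≤ K_z (Σ_{s P-smooth} y^{Ω(s)}/s)^k < ∞` (`tailsTwo_smoothSeries`); dyadic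
blocks.  Both named facts are genuinely used: for `y` close to `2` a single `n ≤ x` with `∏ fᵢ(n)` too smooth would
break the bound, and only the `p`-adic Roth theorem excludes it (cf. `Negative/NoSpikes`), for the pair as well.
-/

open Filter Finset Polynomial
open scoped BigOperators Topology Classical

namespace Summit.Parity.BatemanHorn.Cruxes.LSDRealSegment.ProductAnatomySubcritical

open Literature.NumberTheory.Sieve
open Literature.NumberTheory.DiophantineApproximation
open ArithmeticFunction (cardFactors)
noncomputable section

variable {k : ℕ}

/-! ### Class densities: `#classes(s)/M(s) ≤ K/∏ sᵢ` -/

/-- A Bateman–Horn system of total degree `2` has one or two members. [folklore] -/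
theorem eq_one_or_two_of_sum_natDegree {f : Fin k → ℤ[X]} (hf : IsBatemanHornSystem f)
    (hdeg : (∑ i, (f i).natDegree) = 2) : k = 1 ∨ k = 2 := by
  have h1 : k ≤ 2 := by
    have : ∑ _i : Fin k, 1 ≤ ∑ i, (f i).natDegree := Finset.sum_le_sum fun i _ => hf.natDegree_pos i
    simp at this
    omega
  have h2 : k ≠ 0 := by
    rintro rfl
    simp at hdeg
  omega

/-- **tailsTwo_classDensity_le** (registered helper of `stub_tailsTwo`, line `product-anatomy-subcritical`): for a
Bateman–Horn system of total degree `2` the density of the classes of a slice is `≤ K/∏ sᵢ` —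
`#classes(s) ≤ P# ρ_F(lcm s) ≤ P# C^{π(P)}` (`tailsTwo_slice_card`), `M(s) = lcm(s) P#`, and `∏ sᵢ ≤ |c| lcm(s)` whenever the
slice is non-empty (for a pair, `gcd(s₁, s₂)` divides the constant `c` of a Bézout identity `f₁a + f₂b = c`). [folklore] -/
theorem tailsTwo_classDensity_le : ∀ (k : ℕ) (f : Fin k → ℤ[X]), IsBatemanHornSystem f → (∑ i, (f i).natDegree) = 2 →
    ∀ P : ℕ, ∃ Kz : ℝ, 0 ≤ Kz ∧ ∀ s : Fin k → ℕ, (∀ i, s i ≠ 0) → (∀ i, ∀ p ∈ (s i).primeFactors, p ≤ P) →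
      (#((Finset.range (Finset.univ.lcm s * primorial P)).filter (fun r : ℕ =>
          ∀ i, ((s i : ℕ) : ℤ) ∣ (f i).eval (r : ℤ) ∧ ∀ p ∈ Nat.primesLE P,
            ¬ ((p ^ ((s i).factorization p + 1) : ℕ) : ℤ) ∣ (f i).eval (r : ℤ))) : ℝ) /
        ((Finset.univ.lcm s * primorial P : ℕ) : ℝ) ≤ Kz / ((∏ i, s i : ℕ) : ℝ) := by
  intro k f hf hdeg P
  obtain ⟨Cρ, hCρ⟩ := exists_polyRootCountMod_prime_pow_le_of_system hf
  set Kρ : ℕ := (max Cρ 1) ^ (Nat.primesLE P).card with hKρ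
  -- the Bezout constant `c` (only needed for two members): prod s_i <= c * lcm(s) on non-empty slices
  have hc : ∃ c : ℕ, 1 ≤ c ∧ ∀ s : Fin k → ℕ, (∀ i, s i ≠ 0) → ∀ r : ℕ, (∀ i, ((s i : ℕ) : ℤ) ∣ (f i).eval (r : ℤ)) →
      ∏ i, s i ≤ c * Finset.univ.lcm s := by
    rcases eq_one_or_two_of_sum_natDegree hf hdeg with rfl | rfl
    · refine ⟨1, le_rfl, fun s _ r _ => ?_⟩
      rw [Fin.prod_univ_one, one_mul]
      exact Nat.le_of_dvd (Nat.pos_of_ne_zero (univ_lcm_ne_zero ‹_›)) (dvd_univ_lcm s 0)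
    · obtain ⟨a, b, c, hc0, habc⟩ := exists_mul_add_mul_eq_C_of_not_associated (hf.irreducible 0) (hf.irreducible 1)
        (hf.pairwise_not_associated (by decide))
      refine ⟨c.natAbs, Int.natAbs_pos.mpr hc0, fun s hs r hr => ?_⟩
      have hg : s 0 * s 1 = Nat.gcd (s 0) (s 1) * Nat.lcm (s 0) (s 1) := (Nat.gcd_mul_lcm (s 0) (s 1)).symm
      have hgcd : Nat.gcd (s 0) (s 1) ∣ c.natAbs := by
        rw [← Int.natCast_dvd]
        have h0 : ((Nat.gcd (s 0) (s 1) : ℕ) : ℤ) ∣ (f 0).eval (r : ℤ) :=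
          (Int.natCast_dvd_natCast.mpr (Nat.gcd_dvd_left _ _)).trans (hr 0)
        have h1 : ((Nat.gcd (s 0) (s 1) : ℕ) : ℤ) ∣ (f 1).eval (r : ℤ) :=
          (Int.natCast_dvd_natCast.mpr (Nat.gcd_dvd_right _ _)).trans (hr 1)
        have := congr_arg (eval (r : ℤ)) habc
        rw [eval_add, eval_mul, eval_mul, eval_C] at this
        rw [← this]
        exact dvd_add (dvd_mul_of_dvd_left h0 _) (dvd_mul_of_dvd_left h1 _)
      have hlcm : Nat.lcm (s 0) (s 1) ≤ Finset.univ.lcm s :=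
        Nat.le_of_dvd (Nat.pos_of_ne_zero (univ_lcm_ne_zero hs)) (Nat.lcm_dvd (dvd_univ_lcm s 0) (dvd_univ_lcm s 1))
      rw [Fin.prod_univ_two, hg]
      exact Nat.mul_le_mul (Nat.le_of_dvd (Int.natAbs_pos.mpr hc0) hgcd) hlcm
  obtain ⟨c, hc1, hc⟩ := hc
  refine ⟨c * Kρ, by positivity, fun s hs hsP => ?_⟩
  set L := Finset.univ.lcm s with hL
  set M := L * primorial P with hM
  have hL0 : L ≠ 0 := univ_lcm_ne_zero hs
  have hM0 : (0 : ℝ) < (M : ℝ) := by rw [hM]; exact_mod_cast Nat.pos_of_ne_zero (mul_ne_zero hL0 (primorial_ne_zero P))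
  have hprod0' : 0 < ∏ i, s i := Finset.prod_pos fun i _ => Nat.pos_of_ne_zero (hs i)
  have hprod0 : (0 : ℝ) < ((∏ i, s i : ℕ) : ℝ) := by exact_mod_cast hprod0'
  rcases ((Finset.range M).filter (fun r : ℕ => ∀ i, ((s i : ℕ) : ℤ) ∣ (f i).eval (r : ℤ) ∧ ∀ p ∈ Nat.primesLE P,
    ¬ ((p ^ ((s i).factorization p + 1) : ℕ) : ℤ) ∣ (f i).eval (r : ℤ))).eq_empty_or_nonempty with hRe | ⟨r, hr⟩
  · rw [hRe, Finset.card_empty, Nat.cast_zero, zero_div]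
    positivity
  · have hcard := tailsTwo_slice_card k f s P hs
    have hρ : polyRootCountMod f L ≤ Kρ :=
      polyRootCountMod_smooth_le f (C := max Cρ 1) (fun p hp a => (hCρ p hp a).trans (le_max_left _ _))
        (le_max_right _ _) hL0 (primeFactors_univ_lcm_le hs hsP)
    have hprod : ∏ i, s i ≤ c * L := hc s hs r fun i => ((Finset.mem_filter.mp hr).2 i).1
    rw [div_le_div_iff₀ hM0 hprod0]
    calc _ ≤ ((primorial P * Kρ : ℕ) : ℝ) * ((c * L : ℕ) : ℝ) := by
          have h1 : (#((Finset.range M).filter (fun r : ℕ => ∀ i, ((s i : ℕ) : ℤ) ∣ (f i).eval (r : ℤ) ∧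
              ∀ p ∈ Nat.primesLE P, ¬ ((p ^ ((s i).factorization p + 1) : ℕ) : ℤ) ∣ (f i).eval (r : ℤ))) : ℝ) ≤
              ((primorial P * Kρ : ℕ) : ℝ) := by
            exact_mod_cast hcard.trans (Nat.mul_le_mul_left _ hρ)
          have h2 : ((∏ i, s i : ℕ) : ℝ) ≤ ((c * L : ℕ) : ℝ) := by exact_mod_cast hprod
          exact mul_le_mul h1 h2 hprod0.le (Nat.cast_nonneg _)
      _ = (c * Kρ : ℝ) * (M : ℝ) := by rw [hM]; push_cast; ring

/-! ### The dyadic assembly -/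

/-- **Dyadic assembly**: block bounds `Σ_{X < n ≤ 2X} w(n) ≤ C X (log X)^e` (`X ≥ X₀`, `w ≥ 0`, `e ≥ 0`) give
`Σ_{n ≤ x} w(n) ≤ C' x (log x)^e` for `x ≥ 2`. [folklore] -/
theorem sum_range_le_of_blocks {w : ℕ → ℝ} (hw : ∀ n, 0 ≤ w n) {e C : ℝ} (he : 0 ≤ e) (hC : 0 ≤ C) {X₀ : ℕ}
    (hblk : ∀ X : ℕ, X₀ ≤ X → ∑ n ∈ Finset.Ioc X (2 * X), w n ≤ C * ((X : ℝ) * Real.log X ^ e)) :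
    ∃ C' : ℝ, ∀ x : ℕ, 2 ≤ x → ∑ n ∈ Finset.range (x + 1), w n ≤ C' * ((x : ℝ) * Real.log x ^ e) := by
  set N₁ : ℕ := 2 * X₀ + 2 with hN₁
  set A : ℝ := ∑ n ∈ Finset.range (N₁ + 1), w n with hA
  have hA0 : 0 ≤ A := Finset.sum_nonneg fun n _ => hw n
  -- strong induction: `S(N) ≤ A + 3C N (log N)^e`
  have key : ∀ N : ℕ, ∑ n ∈ Finset.range (N + 1), w n ≤ A + 3 * C * ((N : ℝ) * Real.log N ^ e) := by
    intro N
    induction N using Nat.strong_induction_on with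
    | _ N ih =>
      rcases lt_or_ge N N₁ with hN | hN
      · calc ∑ n ∈ Finset.range (N + 1), w n ≤ A :=
              Finset.sum_le_sum_of_subset_of_nonneg (Finset.range_subset_range.mpr (by omega)) fun n _ _ => hw n
          _ ≤ A + 3 * C * ((N : ℝ) * Real.log N ^ e) := by
              have : 0 ≤ Real.log N ^ e := Real.rpow_nonneg (Real.log_natCast_nonneg N) e
              nlinarith [mul_nonneg (Nat.cast_nonneg (α := ℝ) N) this]
      · set X : ℕ := (N + 1) / 2 with hX
        have hXN : X < N := by omega
        have hX₀ : X₀ ≤ X := by omega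
        have hN2X : N ≤ 2 * X := by omega
        have hX1 : 1 ≤ X := by omega
        have hsplit : ∑ n ∈ Finset.range (N + 1), w n = ∑ n ∈ Finset.range (X + 1), w n + ∑ n ∈ Finset.Ioc X N, w n := by
          have hIoc : Finset.Ico (X + 1) (N + 1) = Finset.Ioc X N := by
            ext n; simp only [Finset.mem_Ico, Finset.mem_Ioc]; omega
          rw [Finset.range_eq_Ico, Finset.range_eq_Ico, ← Finset.Ico_union_Ico_eq_Ico (Nat.zero_le _) (by omega : X + 1 ≤ N + 1),
            Finset.sum_union (Finset.Ico_disjoint_Ico_consecutive _ _ _), hIoc]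
        have hblock : ∑ n ∈ Finset.Ioc X N, w n ≤ C * ((X : ℝ) * Real.log X ^ e) :=
          (Finset.sum_le_sum_of_subset_of_nonneg (Finset.Ioc_subset_Ioc_right hN2X) fun n _ _ => hw n).trans (hblk X hX₀)
        have hXr : (X : ℝ) ≤ N := by exact_mod_cast hXN.le
        have hX0 : (0 : ℝ) < X := by exact_mod_cast hX1
        have hlog : Real.log X ^ e ≤ Real.log N ^ e :=
          Real.rpow_le_rpow (Real.log_natCast_nonneg X) (Real.log_le_log hX0 hXr) he
        have hlog0 : 0 ≤ Real.log N ^ e := Real.rpow_nonneg (Real.log_natCast_nonneg N) e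
        have hXN' : 2 * (X : ℝ) ≤ N + 1 := by
          have : 2 * X ≤ N + 1 := by omega
          exact_mod_cast this
        have hN2 : (2 : ℝ) ≤ N := by
          have : 2 ≤ N := by omega
          exact_mod_cast this
        rw [hsplit]
        calc ∑ n ∈ Finset.range (X + 1), w n + ∑ n ∈ Finset.Ioc X N, w n
            ≤ (A + 3 * C * ((X : ℝ) * Real.log X ^ e)) + C * ((X : ℝ) * Real.log X ^ e) := add_le_add (ih X hXN) hblock
          _ ≤ A + 4 * C * ((X : ℝ) * Real.log N ^ e) := by nlinarith [mul_le_mul_of_nonneg_left hlog hX0.le]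
          _ ≤ A + 3 * C * ((N : ℝ) * Real.log N ^ e) := by nlinarith [mul_nonneg hC hlog0]
  have hl2 : 0 < Real.log 2 ^ e := Real.rpow_pos_of_pos (Real.log_pos one_lt_two) e
  refine ⟨A / (2 * Real.log 2 ^ e) + 3 * C, fun x hx => (key x).trans ?_⟩
  have hxr : (2 : ℝ) ≤ x := by exact_mod_cast hx
  have hlog : Real.log 2 ^ e ≤ Real.log x ^ e :=
    Real.rpow_le_rpow (Real.log_nonneg one_le_two) (Real.log_le_log two_pos hxr) he
  have h1 : A ≤ A / (2 * Real.log 2 ^ e) * ((x : ℝ) * Real.log x ^ e) := by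
    rw [div_mul_eq_mul_div, le_div_iff₀ (by positivity)]
    calc A * (2 * Real.log 2 ^ e) ≤ A * ((x : ℝ) * Real.log x ^ e) :=
          mul_le_mul_of_nonneg_left (mul_le_mul hxr hlog hl2.le (by linarith)) hA0
      _ = _ := by ring
  nlinarith

/-! ### The peeled weights -/

/-- The peeled weight `y^{Ω(roughPart P m)}`: class `𝓜(y, 1, ε)` (once `P^ε ≥ y`), rough-part dependent, `= 1` at `1`,
and dominated by `y^{Ω(m)}`. [folklore] -/
theorem peeledWeight_props {y ε : ℝ} {P : ℕ} (hy : 1 ≤ y) (hε : 0 < ε) (hP : 1 ≤ P) (hyP : y ≤ (P : ℝ) ^ ε) :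
    IsClassM y 1 ε (fun m => y ^ cardFactors (roughPart (P : ℝ) m)) ∧
    (∀ m, y ^ cardFactors (roughPart (P : ℝ) m) = y ^ cardFactors (roughPart (P : ℝ) (roughPart (P : ℝ) m))) ∧
    y ^ cardFactors (roughPart (P : ℝ) 1) ≤ 1 ∧
    (∀ m, y ^ cardFactors (roughPart (P : ℝ) m) ≤ y ^ cardFactors m) := by
  have heq : (fun m => y ^ cardFactors (roughPart (P : ℝ) m)) = fun m => y ^ cardFactors (m / smoothPart (P : ℝ) m) := by
    funext m
    rcases eq_or_ne m 0 with rfl | hm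
    · simp [roughPart]
    · rw [roughPart_eq_div _ hm]
  refine ⟨?_, fun m => by rw [roughPart_roughPart], by simp [roughPart], fun m => ?_⟩
  · rw [heq]
    exact tails_peeledWeight_isClassM y ε P hy hε (by exact_mod_cast hP) hyP
  · rcases eq_or_ne m 0 with rfl | hm
    · simp [roughPart]
    · rw [roughPart_eq_div _ hm]
      exact pow_le_pow_right₀ hy (cardFactors_div_smoothPart_le _ hm)

/-- `y^{Ω_f(n)} = ∏ᵢ y^{Ω(val f i n)}` and each factor splits over the `P`-smooth / `P`-rough parts. [folklore] -/
theorem pow_stat_eq_prod_smooth_rough (f : Fin k → ℤ[X]) (y : ℝ) (P n : ℕ) :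
    y ^ stat f n = ∏ i, (y ^ cardFactors (smoothPart (P : ℝ) (val f i n)) * y ^ cardFactors (roughPart (P : ℝ) (val f i n))) := by
  rw [stat, ← Finset.prod_pow_eq_pow_sum]
  refine Finset.prod_congr rfl fun i _ => ?_
  rw [← pow_cardFactors_eq_smooth_mul_rough y _ (by rw [val]; positivity : val f i n ≠ 0), val, cardFactors_max_one]

/-! ### The a priori bound -/

/-- **tailsTwo_aPrioriBound_of_facts** (registered helper of `stub_tailsTwo`, line `product-anatomy-subcritical`;
CONDITIONAL on the named facts `NairTenenbaum1998_theorem1` and `BugeaudEvertseGyory2018_SPartPolynomialValues`):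
clause (a) of `stub_tailsTwo` — `APrioriBound k f y` for every Bateman–Horn system of total degree `2` and every
`1 ≤ y < 2`. [folklore] -/
theorem tailsTwo_aPrioriBound_of_facts : NairTenenbaum1998_theorem1 → BugeaudEvertseGyory2018_SPartPolynomialValues →
    ∀ (k : ℕ) (f : Fin k → ℤ[X]), IsBatemanHornSystem f → (∑ i, (f i).natDegree) = 2 →
    ∀ y : ℝ, 1 ≤ y → y < 2 → APrioriBound k f y := by
  intro hNT hBEG k f hf hdeg y hy hy2
  have hy0 : 0 ≤ y := by linarith
  set lam : ℝ := Real.logb 2 y with hlam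
  have hlam1 : lam < 1 := by
    rw [hlam, Real.logb_lt_iff_lt_rpow one_lt_two (by linarith), Real.rpow_one]; exact hy2
  set θ : ℝ := (1 - lam) / 6 with hθdef
  have hθ : 0 < θ := by rw [hθdef]; linarith
  set ε₁ : ℝ := (1 - Real.logb 2 y) / (9216 * (k + 1)) with hε₁def
  have hε₁ : 0 < ε₁ := by rw [hε₁def]; exact div_pos (by rw [← hlam]; linarith) (by positivity)
  -- the cut `P` with `P^{ε₁} ≥ y`
  set P : ℕ := ⌊y ^ (1 / ε₁)⌋₊ + 1 with hPdef
  have hP1 : 1 ≤ P := by omega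
  have hyP : y ≤ (P : ℝ) ^ ε₁ := by
    have h1 : y ^ (1 / ε₁) ≤ (P : ℝ) := by
      rw [hPdef]; push_cast; exact (Nat.lt_floor_add_one _).le
    calc y = (y ^ (1 / ε₁)) ^ ε₁ := by rw [← Real.rpow_mul hy0, one_div_mul_cancel hε₁.ne', Real.rpow_one]
      _ ≤ (P : ℝ) ^ ε₁ := Real.rpow_le_rpow (by positivity) h1 hε₁.le
  obtain ⟨hcls, hFr, hF1, hFle⟩ := peeledWeight_props hy hε₁ hP1 hyP
  -- the engine, the harmonic factors, the class densities, the smooth series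
  obtain ⟨C, X₀, hC0, hengine⟩ := tailsTwo_engine hNT hBEG k f hf hdeg y y 1 P hy hy2 hy le_rfl
  obtain ⟨Ch', hCh'⟩ := tails_rootCountHarmonic_le k f hf y hy hy2
  obtain ⟨Kz, hKz0, hKz⟩ := tailsTwo_classDensity_le k f hf hdeg P
  obtain ⟨⟨Ks, hKs⟩, -⟩ := tailsTwo_smoothSeries y P hy hy2
  set Ch : ℝ := max Ch' 0 with hChdef
  have hCh0 : 0 ≤ Ch := le_max_right _ _
  have hCh : ∀ (j : Fin k) (N : ℕ), 2 ≤ N →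
      (∑ m ∈ Finset.Icc 1 N, y ^ cardFactors m * (polyRootCountMod ![f j] m : ℝ) / m) ≤ Ch * Real.log N ^ y :=
    fun j N hN => (hCh' j N hN).trans (mul_le_mul_of_nonneg_right (le_max_left _ _)
      (Real.rpow_nonneg (Real.log_natCast_nonneg N) y))
  have hKs0 : 0 ≤ Ks := le_trans (Finset.sum_nonneg fun m _ => by positivity) (hKs 1)
  -- the block bound
  set e : ℝ := (k : ℝ) * (y - 1) with he
  have he0 : 0 ≤ e := by positivity
  set Cblk : ℝ := C * (Ch * 2 ^ y) ^ k * (Kz * Ks ^ k) + 1 / Real.log 2 ^ e with hCblk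
  have hblk : ∀ X : ℕ, max X₀ 2 ≤ X → ∑ n ∈ Finset.Ioc X (2 * X), y ^ stat f n ≤ Cblk * ((X : ℝ) * Real.log X ^ e) := by
    intro X hX
    have hXX₀ : X₀ ≤ X := le_of_max_le_left hX
    have hX2 : 2 ≤ X := le_of_max_le_right hX
    have hXr : (2 : ℝ) ≤ X := by exact_mod_cast hX2
    have hXpos : (0 : ℝ) < X := by linarith
    have hlogX : 0 < Real.log X := Real.log_pos (by linarith)
    have hlog2 : Real.log 2 ≤ Real.log X := Real.log_le_log two_pos hXr
    have h := hengine (fun _ m => y ^ cardFactors (roughPart (P : ℝ) m)) (fun _ => hcls) (fun _ m => hFr m)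
      (fun _ => hF1) (fun _ => True) X hXX₀
    simp only [Finset.filter_true] at h
    rw [Finset.sum_congr rfl fun n _ => pow_stat_eq_prod_smooth_rough f y P n]
    refine h.trans ?_
    -- the harmonic factors
    have hH : ∏ i, ∑ m ∈ Finset.Icc 1 (2 * X), y ^ cardFactors (roughPart (P : ℝ) m) * (polyRootCountMod ![f i] m : ℝ) / m ≤
        (Ch * 2 ^ y) ^ k * Real.log X ^ (y * k) := by
      have hone : ∀ i, ∑ m ∈ Finset.Icc 1 (2 * X), y ^ cardFactors (roughPart (P : ℝ) m) * (polyRootCountMod ![f i] m : ℝ) / m ≤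
          Ch * 2 ^ y * Real.log X ^ y := by
        intro i
        calc _ ≤ ∑ m ∈ Finset.Icc 1 (2 * X), y ^ cardFactors m * (polyRootCountMod ![f i] m : ℝ) / m :=
              Finset.sum_le_sum fun m _ => div_le_div_of_nonneg_right
                (mul_le_mul_of_nonneg_right (hFle m) (Nat.cast_nonneg _)) (Nat.cast_nonneg _)
          _ ≤ Ch * Real.log ((2 * X : ℕ) : ℝ) ^ y := hCh i (2 * X) (by omega)
          _ ≤ Ch * (2 * Real.log X) ^ y := by
              refine mul_le_mul_of_nonneg_left (Real.rpow_le_rpow (Real.log_natCast_nonneg _) ?_ hy0) hCh0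
              push_cast
              rw [Real.log_mul two_ne_zero hXpos.ne']
              linarith
          _ = Ch * 2 ^ y * Real.log X ^ y := by rw [Real.mul_rpow zero_le_two hlogX.le]; ring
      calc _ ≤ ∏ _i : Fin k, Ch * 2 ^ y * Real.log X ^ y :=
            Finset.prod_le_prod (fun i _ => Finset.sum_nonneg fun m _ => by positivity) fun i _ => hone i
        _ = (Ch * 2 ^ y) ^ k * (Real.log X ^ y) ^ k := by
            rw [Finset.prod_const, Finset.card_univ, Fintype.card_fin, mul_pow]
        _ = (Ch * 2 ^ y) ^ k * Real.log X ^ (y * k) := by rw [← Real.rpow_natCast (Real.log X ^ y), ← Real.rpow_mul hlogX.le]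
    -- the densities
    have hZ : ∑ s ∈ (Fintype.piFinset fun _ : Fin k => Finset.Icc 1 X).filter
          (fun s => (∀ i, ∀ p ∈ (s i).primeFactors, p ≤ P) ∧ True),
        y ^ cardFactors (∏ i, s i) *
          (#((Finset.range (Finset.univ.lcm s * primorial P)).filter (fun r : ℕ =>
              ∀ i, ((s i : ℕ) : ℤ) ∣ (f i).eval (r : ℤ) ∧ ∀ p ∈ Nat.primesLE P,
                ¬ ((p ^ ((s i).factorization p + 1) : ℕ) : ℤ) ∣ (f i).eval (r : ℤ))) : ℝ) /
          ((Finset.univ.lcm s * primorial P : ℕ) : ℝ) ≤ Kz * Ks ^ k := by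
      set box := (Fintype.piFinset fun _ : Fin k => Finset.Icc 1 X).filter
        (fun s => (∀ i, ∀ p ∈ (s i).primeFactors, p ≤ P) ∧ True) with hbox
      have hpt : ∀ s ∈ box, y ^ cardFactors (∏ i, s i) *
          (#((Finset.range (Finset.univ.lcm s * primorial P)).filter (fun r : ℕ =>
              ∀ i, ((s i : ℕ) : ℤ) ∣ (f i).eval (r : ℤ) ∧ ∀ p ∈ Nat.primesLE P,
                ¬ ((p ^ ((s i).factorization p + 1) : ℕ) : ℤ) ∣ (f i).eval (r : ℤ))) : ℝ) /
          ((Finset.univ.lcm s * primorial P : ℕ) : ℝ) ≤ Kz * ∏ i, (y ^ cardFactors (s i) / (s i)) := by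
        intro s hs
        rw [hbox, Finset.mem_filter, Fintype.mem_piFinset] at hs
        have hs1 : ∀ i, s i ≠ 0 := fun i => by have := (Finset.mem_Icc.mp (hs.1 i)).1; omega
        have hd := hKz s hs1 hs.2.1
        rw [mul_div_assoc, cardFactors_finset_prod _ _ fun i _ => hs1 i, ← Finset.prod_pow_eq_pow_sum]
        calc (∏ i, y ^ cardFactors (s i)) * _ ≤ (∏ i, y ^ cardFactors (s i)) * (Kz / ((∏ i, s i : ℕ) : ℝ)) :=
              mul_le_mul_of_nonneg_left hd (Finset.prod_nonneg fun i _ => pow_nonneg hy0 _)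
          _ = Kz * ∏ i, (y ^ cardFactors (s i) / (s i)) := by
              rw [Finset.prod_div_distrib, Nat.cast_prod]; ring
      refine (Finset.sum_le_sum hpt).trans ?_
      rw [← Finset.mul_sum]
      refine mul_le_mul_of_nonneg_left ?_ hKz0
      have hsub : box ⊆ Fintype.piFinset fun _ : Fin k => (Finset.Icc 1 X).filter fun m : ℕ => ∀ p ∈ m.primeFactors, p ≤ P := by
        intro s hs
        rw [hbox, Finset.mem_filter, Fintype.mem_piFinset] at hs
        exact Fintype.mem_piFinset.mpr fun i => Finset.mem_filter.mpr ⟨hs.1 i, hs.2.1 i⟩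
      calc ∑ s ∈ box, ∏ i, (y ^ cardFactors (s i) / (s i))
          ≤ ∑ s ∈ Fintype.piFinset (fun _ : Fin k => (Finset.Icc 1 X).filter fun m : ℕ => ∀ p ∈ m.primeFactors, p ≤ P),
              ∏ i, (y ^ cardFactors (s i) / (s i)) :=
            Finset.sum_le_sum_of_subset_of_nonneg hsub fun s _ _ => Finset.prod_nonneg fun i _ => by positivity
        _ = ∏ _i : Fin k, ∑ m ∈ (Finset.Icc 1 X).filter (fun m : ℕ => ∀ p ∈ m.primeFactors, p ≤ P), y ^ cardFactors m / m :=
            (Finset.prod_univ_sum (fun _ : Fin k => (Finset.Icc 1 X).filter fun m : ℕ => ∀ p ∈ m.primeFactors, p ≤ P)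
              (fun _ m => y ^ cardFactors m / m)).symm
        _ ≤ ∏ _i : Fin k, Ks := Finset.prod_le_prod (fun i _ => Finset.sum_nonneg fun m _ => by positivity) fun i _ => hKs X
        _ = Ks ^ k := by rw [Finset.prod_const, Finset.card_univ, Fintype.card_fin]
    -- assemble the block
    have hpow : Real.log X ^ (y * k) / Real.log X ^ k = Real.log X ^ e := by
      rw [← Real.rpow_natCast (Real.log X) k, ← Real.rpow_sub hlogX, he]; ring_nf
    have hsparse : (X : ℝ) ^ (1 - (1 - Real.logb 2 y) / 6) ≤ 1 / Real.log 2 ^ e * ((X : ℝ) * Real.log X ^ e) := by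
      have h1 : (X : ℝ) ^ (1 - (1 - Real.logb 2 y) / 6) ≤ X := by
        calc (X : ℝ) ^ (1 - (1 - Real.logb 2 y) / 6) ≤ (X : ℝ) ^ (1 : ℝ) :=
              Real.rpow_le_rpow_of_exponent_le (by linarith) (by rw [← hlam]; linarith)
          _ = X := Real.rpow_one _
      have h2 : Real.log 2 ^ e ≤ Real.log X ^ e := Real.rpow_le_rpow (Real.log_nonneg one_le_two) hlog2 he0
      have hl2 : 0 < Real.log 2 ^ e := Real.rpow_pos_of_pos (Real.log_pos one_lt_two) e
      rw [div_mul_eq_mul_div, le_div_iff₀ hl2, one_mul]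
      calc (X : ℝ) ^ (1 - (1 - Real.logb 2 y) / 6) * Real.log 2 ^ e ≤ X * Real.log X ^ e :=
            mul_le_mul h1 h2 hl2.le (by linarith)
        _ = _ := by ring
    calc C * ((X : ℝ) / Real.log X ^ k) * (∏ i, ∑ m ∈ Finset.Icc 1 (2 * X),
          y ^ cardFactors (roughPart (P : ℝ) m) * (polyRootCountMod ![f i] m : ℝ) / m) * _ + (X : ℝ) ^ (1 - (1 - Real.logb 2 y) / 6)
        ≤ C * ((X : ℝ) / Real.log X ^ k) * ((Ch * 2 ^ y) ^ k * Real.log X ^ (y * k)) * (Kz * Ks ^ k) +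
            1 / Real.log 2 ^ e * ((X : ℝ) * Real.log X ^ e) := by
          refine add_le_add (mul_le_mul (mul_le_mul_of_nonneg_left hH (by positivity)) ?_ ?_ (by positivity)) hsparse
          · convert hZ
            rfl
          · exact Finset.sum_nonneg fun s _ => div_nonneg (mul_nonneg (pow_nonneg hy0 _) (Nat.cast_nonneg _)) (Nat.cast_nonneg _)
      _ = C * (Ch * 2 ^ y) ^ k * (Kz * Ks ^ k) * ((X : ℝ) * (Real.log X ^ (y * k) / Real.log X ^ k)) +
            1 / Real.log 2 ^ e * ((X : ℝ) * Real.log X ^ e) := by ring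
      _ = Cblk * ((X : ℝ) * Real.log X ^ e) := by rw [hpow, hCblk]; ring
  obtain ⟨C', hC'⟩ := sum_range_le_of_blocks (w := fun n => y ^ stat f n) (fun n => pow_nonneg hy0 _) he0
    (by positivity : 0 ≤ Cblk) hblk
  exact ⟨C', fun x hx => hC' x hx⟩

end

end Summit.Parity.BatemanHorn.Cruxes.LSDRealSegment.ProductAnatomySubcritical
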